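import Literature.NumberTheory.ComplexMultiplication.ShimuraReciprocityExtendedRingClassProofs
import Literature.LinearAlgebra.Matrix.SpecialLinearReductionSurjective
import HarnessLib

/-!
# Route `PrintCf2`, crux stmt-BirchSwinnertonDyer-20509 `RamifiedOffTYZOfFacts`, THEOREM A's step (R1) in the kernel:
# the Artin symbol of a principal ideal `(β)`, `β = A + Bθ`, acts on `s(τ₀) = η₁₆³/(η₈η₃₂²)(τ₀)` by the SIGN `χ₈(n′A)`, `n′N(β) ≡ 1 (32)`
# (cell `bsd-print-cf2`, LEAD cruxlead-20509 g32, line `offtyz-v7`, lineage cycle 33; `def`-free; conditional on the ONE display fact of Cox Thm 15.16–17)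

HONEST FRAMING (`--supports stmt-BirchSwinnertonDyer-20509`; theorems only, no `sorry`, no new named fact).  BSD is not proved by any of this; no
class is closed by this file; item 23431 (C⁺) and crux 20509 stay OPEN.  This is step (R1) of THEOREM A's kernel road (memo
`Cruxes/RamifiedOffTYZOfFacts/Lines/offtyz_v7_TheoremARoad.md` §3): the LEAD's g29 sentence «`s(τ)^{σ_u} = (2/x)(2/N(u))·s(τ)`» (memo
`Lines/offtyz_v7_ExactDescent.md` §2b) BY NAME, granted the display fact `Cox2013.cox2013_shimuraReciprocity_rayClassField` (ty2 g51, p809658) —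
the hypothesis `h` below; nothing else is assumed.

For `K` imaginary quadratic, `ι : K → ℂ`, a primitive positive definite form `(a, b, c)` with `32 ∣ a` (TYZ's level-`32` Heegner forms
`Q_{n,δ} = ((n+δ²)/4, δ, 1)`, `128 ∣ n + δ²`: `dvd_sevenBlockForm_fst`), `θ = a·τ₀ ∈ 𝓞 K` generating `𝓞 K`, `e : K^{(32)} → ℂ` over `ι`, and
`y ∈ K^{(32)}` with `e y = s(τ₀)` (it exists: Cox 15.16, `artinSymbol_etaQuotient_rS_of_fact` part 1):

* `exists_SL2_lift_gBar` — a matrix `γ ∈ SL(2,ℤ)` with `γ ≡ (A − bB, −cB; n′aB, n′A) (mod 32)` exists whenever `n′(A² − bAB + acB²) ≡ 1 (mod 32)`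
  (the tree's Andrianov–Zhuravlev lift `exists_specialLinearGroup_intModEq`), and it lies in `Γ₀(32)` when `32 ∣ a`.
* ★ `artinSymbol_principal_apply_sqrtX` — **`((K^{(32)}|K)/(β)) y = χ₈(n′A) · y`**: by the fact, `e` of the left side is `s(γ·τ₀)`; by Newman's
  theorem with character (ty2 g51 p809960 `etaQuotient_rS_smul`, PROVED) `s(γ·τ₀) = χ₈(d_γ)·s(τ₀)` with `d_γ ≡ n′A (mod 32)`; `e` is injective.
* `artinSymbol_principal_apply_sqrtX_eq_self_or_neg` — hence the Artin symbols of principal ideals act on `y` through `{±1}`;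
  `artinSymbol_principal_apply_sqrtX_eq_self` — and TRIVIALLY as soon as `χ₈(n′A) = 1`, e.g. (`…_of_mod_eight`) when `n′A ≡ ±1 (mod 8)`.

What (R2) will feed in: for `K = ℚ(√−lq)`, `γ = ±β₀²·l^ε` has `N(γ)` an odd square times `l^{2ε}` and `γ ≡ ±β₀,𝔭² l^ε (mod 𝔭³)`, so
`n′A ≡ ±1 (mod 8)` (`l ≡ 1 (mod 8)`, squares of odd numbers are `1 mod 8`) and the symbol is trivial — the «order-two arithmetic» of the road.

References: [cite: Cox2013, Thm. 15.16, Thm. 15.17 (p. 347–348), proof p. 358–359]; [cite: Savitt2025, Thm. 1]; [cite: AndrianovZhuravlev2015, Chap. 3 Lemma 3.2 (1)];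
tree: p809658, p809960, p810388, `Literature/LinearAlgebra/Matrix/SpecialLinearReductionSurjective.lean`.
-/

noncomputable section

open UpperHalfPlane hiding I
open NumberField IsDedekindDomain Complex
open scoped MatrixGroups

namespace Summit.BirchSwinnertonDyer.PrintCf2.TheoremAReciprocity

open Literature.NumberTheory.NumberFields Literature.NumberTheory.GaloisRepresentations
open Literature.NumberTheory.EllipticCurves (heegnerTau)
open Literature.NumberTheory.EllipticCurves.ModularForms
open Literature.NumberTheory.ComplexMultiplication.Cox2013
open Literature.LinearAlgebra.Matrix.IntegerSpecialLinear

/-! ## §1 The lift of `(1 0; 0 n′)·ḡ_{τ₀}(β)` to `SL(2,ℤ)`, inside `Γ₀(32)` -/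

/-- **A lift to `SL(2,ℤ)` of `(A − bB, −cB; n′aB, n′A) mod 32`** exists when `n′(A² − bAB + acB²) ≡ 1 (mod 32)`.
[cite: AndrianovZhuravlev2015, Chap. 3 Lemma 3.2 (1)] [cite: Cox2013, Thm. 15.17 (the matrix ḡ_{τ₀}(u))] -/
theorem exists_SL2_lift_gBar (a b c A B n' : ℤ) (hn' : ((n' * (A ^ 2 - b * A * B + a * c * B ^ 2) : ℤ) : ZMod 32) = 1) :
    ∃ γ : SL(2, ℤ), ((γ 0 0 : ℤ) : ZMod 32) = ((A - b * B : ℤ) : ZMod 32) ∧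
      ((γ 0 1 : ℤ) : ZMod 32) = ((-(c * B) : ℤ) : ZMod 32) ∧
      ((γ 1 0 : ℤ) : ZMod 32) = ((n' * (a * B) : ℤ) : ZMod 32) ∧
      ((γ 1 1 : ℤ) : ZMod 32) = ((n' * A : ℤ) : ZMod 32) := by
  let M : Matrix (Fin 2) (Fin 2) ℤ := !![A - b * B, -(c * B); n' * (a * B), n' * A]
  have hdet : M.det = n' * (A ^ 2 - b * A * B + a * c * B ^ 2) := by
    rw [Matrix.det_fin_two_of]; ring
  have hM : M.det ≡ 1 [ZMOD (32 : ℕ)] := by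
    rw [hdet]
    exact (ZMod.intCast_eq_intCast_iff _ _ 32).mp (by rw [hn', Int.cast_one])
  obtain ⟨γ, hγ⟩ := exists_specialLinearGroup_intModEq (n := Fin 2) 32 M hM
  refine ⟨γ, ?_, ?_, ?_, ?_⟩
  · have h := (ZMod.intCast_eq_intCast_iff _ _ 32).mpr (hγ 0 0)
    simpa [M] using h.symm
  · have h := (ZMod.intCast_eq_intCast_iff _ _ 32).mpr (hγ 0 1)
    simpa [M] using h.symm
  · have h := (ZMod.intCast_eq_intCast_iff _ _ 32).mpr (hγ 1 0)
    simpa [M] using h.symm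
  · have h := (ZMod.intCast_eq_intCast_iff _ _ 32).mpr (hγ 1 1)
    simpa [M] using h.symm

/-- Such a lift lies in `Γ₀(32)` when `32 ∣ a`. [cite: Cox2013, §15.C (the condition 𝒪̂ˣ ⊂ U₀(N) when N ∣ a)] -/
theorem mem_Gamma0_of_lift {γ : SL(2, ℤ)} {a B n' : ℤ} (ha : (32 : ℤ) ∣ a)
    (h10 : ((γ 1 0 : ℤ) : ZMod 32) = ((n' * (a * B) : ℤ) : ZMod 32)) : γ ∈ CongruenceSubgroup.Gamma0 32 := by
  rw [CongruenceSubgroup.Gamma0_mem, h10, ZMod.intCast_zmod_eq_zero_iff_dvd]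
  obtain ⟨k, rfl⟩ := ha
  exact ⟨n' * k * B, by push_cast; ring⟩

/-- The `d`-entry of the lift, read modulo `8`: `χ₈(d_γ) = χ₈(n′A)`. [folklore] -/
theorem chi8_entry_eq {γ : SL(2, ℤ)} {A n' : ℤ} (h11 : ((γ 1 1 : ℤ) : ZMod 32) = ((n' * A : ℤ) : ZMod 32)) :
    ZMod.χ₈ ((γ 1 1 : ℤ) : ZMod 8) = ZMod.χ₈ ((n' * A : ℤ) : ZMod 8) := by
  have h8 : ((γ 1 1 : ℤ) : ZMod 8) = ((n' * A : ℤ) : ZMod 8) := by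
    have := congrArg (ZMod.castHom (show 8 ∣ 32 by norm_num) (ZMod 8)) h11
    simpa only [map_intCast] using this
  rw [h8]

/-- `n′(A² − bAB + acB²) ≡ 1 (mod 32)` with `a` even forces `n′A` odd. [folklore] -/
theorem odd_mul_of_norm_inv {a b c A B n' : ℤ} (ha : (2 : ℤ) ∣ a)
    (hn' : ((n' * (A ^ 2 - b * A * B + a * c * B ^ 2) : ℤ) : ZMod 32) = 1) : Odd (n' * A) := by
  have hdvd : (32 : ℤ) ∣ 1 - n' * (A ^ 2 - b * A * B + a * c * B ^ 2) := by
    rw [← Int.cast_one] at hn'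
    exact (ZMod.intCast_eq_intCast_iff_dvd_sub _ _ 32).mp hn'
  obtain ⟨k, hk⟩ := hdvd
  have hodd : Odd (n' * (A ^ 2 - b * A * B + a * c * B ^ 2)) := ⟨-(16 * k), by linarith⟩
  obtain ⟨hn'odd, hNodd⟩ := Int.odd_mul.mp hodd
  obtain ⟨a', rfl⟩ := ha
  have hA : Odd A := by
    have hsplit : A * (A - b * B) = (A ^ 2 - b * A * B + 2 * a' * c * B ^ 2) - 2 * (a' * c * B ^ 2) := by ring
    have h2 : Odd (A * (A - b * B)) := by
      rw [hsplit]
      exact Int.odd_sub.mpr ⟨fun _ => even_two_mul _, fun _ => hNodd⟩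
    exact (Int.odd_mul.mp h2).1
  exact Int.odd_mul.mpr ⟨hn'odd, hA⟩

/-- For odd `m`, `χ₈(m) = ±1`. [folklore] -/
theorem chi8_eq_one_or_neg_one_of_odd {m : ℤ} (hm : Odd m) :
    ZMod.χ₈ ((m : ℤ) : ZMod 8) = 1 ∨ ZMod.χ₈ ((m : ℤ) : ZMod 8) = -1 := by
  rw [ZMod.χ₈_int_eq_if_mod_eight]
  have h2 : m % 2 = 1 := Int.odd_iff.mp hm
  have h8 : m % 8 = 1 ∨ m % 8 = 3 ∨ m % 8 = 5 ∨ m % 8 = 7 := by omega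
  rcases h8 with h | h | h | h <;> simp [h, h2]

/-! ## §2 The Artin symbol of `(β)` on `y = e⁻¹ s(τ₀)` -/

/-- ★ **`((K^{(32)}|K)/(β)) y = χ₈(n′A)·y` for `e y = s(τ₀)`** (`β = A + Bθ ∈ 𝓞 K`, `(β)` prime to `32`, `n′N(β) ≡ 1 (mod 32)`, `32 ∣ a`),
granted Cox's reciprocity display. [cite: Cox2013, Thm. 15.17 (p. 348)] [cite: Savitt2025, Thm. 1] -/
theorem artinSymbol_principal_apply_sqrtX (h : cox2013_shimuraReciprocity_rayClassField)
    (K : Type) [Field K] [NumberField K] (ι : K →+* ℂ)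
    (hK : Literature.NumberTheory.EllipticCurves.IsImaginaryQuadratic K)
    (a b c : ℤ) (ha : 0 < a) (hD : b ^ 2 - 4 * a * c < 0) (hprim : Int.gcd (Int.gcd a b) c = 1) (h32 : (32 : ℤ) ∣ a)
    (θ : 𝓞 K) (hθ : ι (θ : K) = (a : ℂ) * ((heegnerTau (a, b, c) : ℍ) : ℂ))
    (hgen : ∀ z : 𝓞 K, ∃ A B : ℤ, (z : K) = A + B * (θ : K))
    (e : rayClassField K (Ideal.span {((32 : ℕ) : 𝓞 K)}) →+* ℂ)
    (he : ∀ k : K, e (algebraMap K (rayClassField K (Ideal.span {((32 : ℕ) : 𝓞 K)})) k) = ι k)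
    (β : 𝓞 K) (hβ : (β : K) ≠ 0)
    (hβm : toPrincipalIdeal (𝓞 K) K (Units.mk0 (β : K) hβ) ∈ idealsPrimeTo (Ideal.span {((32 : ℕ) : 𝓞 K)}))
    (A B : ℤ) (hAB : (β : K) = A + B * (θ : K))
    (n' : ℤ) (hn' : ((n' * (A ^ 2 - b * A * B + a * c * B ^ 2) : ℤ) : ZMod 32) = 1)
    (y : rayClassField K (Ideal.span {((32 : ℕ) : 𝓞 K)})) (hy : e y = etaQuotient 32 rS (heegnerTau (a, b, c))) :
    artinHom (galFrob K (rayClassField K (Ideal.span {((32 : ℕ) : 𝓞 K)})))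
        (toPrincipalIdeal (𝓞 K) K (Units.mk0 (β : K) hβ)) y =
      ((ZMod.χ₈ ((n' * A : ℤ) : ZMod 8) : ℤ) : rayClassField K (Ideal.span {((32 : ℕ) : 𝓞 K)})) * y := by
  obtain ⟨γ, h00, h01, h10, h11⟩ := exists_SL2_lift_gBar a b c A B n' hn'
  have hrec := (artinSymbol_etaQuotient_rS_of_fact h K ι hK a b c ha hD hprim θ hθ hgen e he).2 β hβ hβm A B hAB n' hn'
    γ h00 h01 h10 h11 y hy
  have hγ0 : γ ∈ CongruenceSubgroup.Gamma0 32 := mem_Gamma0_of_lift h32 h10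
  rw [etaQuotient_rS_smul hγ0, chi8_entry_eq h11, ← hy] at hrec
  -- `e (σ y) = χ · e y = e (χ · y)`; conclude by injectivity of `e`
  apply e.injective
  have hcast : e (((ZMod.χ₈ ((n' * A : ℤ) : ZMod 8) : ℤ) : rayClassField K (Ideal.span {((32 : ℕ) : 𝓞 K)}))) =
      ((ZMod.χ₈ ((n' * A : ℤ) : ZMod 8) : ℤ) : ℂ) := map_intCast e _
  rw [hrec, map_mul, hcast]

/-- The Artin symbol of a principal ideal acts on `y = e⁻¹ s(τ₀)` by `±1`. [cite: Cox2013, Thm. 15.17] [cite: Savitt2025, Thm. 1] -/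
theorem artinSymbol_principal_apply_sqrtX_eq_self_or_neg (h : cox2013_shimuraReciprocity_rayClassField)
    (K : Type) [Field K] [NumberField K] (ι : K →+* ℂ)
    (hK : Literature.NumberTheory.EllipticCurves.IsImaginaryQuadratic K)
    (a b c : ℤ) (ha : 0 < a) (hD : b ^ 2 - 4 * a * c < 0) (hprim : Int.gcd (Int.gcd a b) c = 1) (h32 : (32 : ℤ) ∣ a)
    (θ : 𝓞 K) (hθ : ι (θ : K) = (a : ℂ) * ((heegnerTau (a, b, c) : ℍ) : ℂ))
    (hgen : ∀ z : 𝓞 K, ∃ A B : ℤ, (z : K) = A + B * (θ : K))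
    (e : rayClassField K (Ideal.span {((32 : ℕ) : 𝓞 K)}) →+* ℂ)
    (he : ∀ k : K, e (algebraMap K (rayClassField K (Ideal.span {((32 : ℕ) : 𝓞 K)})) k) = ι k)
    (β : 𝓞 K) (hβ : (β : K) ≠ 0)
    (hβm : toPrincipalIdeal (𝓞 K) K (Units.mk0 (β : K) hβ) ∈ idealsPrimeTo (Ideal.span {((32 : ℕ) : 𝓞 K)}))
    (A B : ℤ) (hAB : (β : K) = A + B * (θ : K))
    (n' : ℤ) (hn' : ((n' * (A ^ 2 - b * A * B + a * c * B ^ 2) : ℤ) : ZMod 32) = 1)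
    (y : rayClassField K (Ideal.span {((32 : ℕ) : 𝓞 K)})) (hy : e y = etaQuotient 32 rS (heegnerTau (a, b, c))) :
    artinHom (galFrob K (rayClassField K (Ideal.span {((32 : ℕ) : 𝓞 K)})))
        (toPrincipalIdeal (𝓞 K) K (Units.mk0 (β : K) hβ)) y = y ∨
    artinHom (galFrob K (rayClassField K (Ideal.span {((32 : ℕ) : 𝓞 K)})))
        (toPrincipalIdeal (𝓞 K) K (Units.mk0 (β : K) hβ)) y = -y := by
  rw [artinSymbol_principal_apply_sqrtX h K ι hK a b c ha hD hprim h32 θ hθ hgen e he β hβ hβm A B hAB n' hn' y hy]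
  have h2a : (2 : ℤ) ∣ a := (show (2 : ℤ) ∣ 32 by norm_num).trans h32
  rcases chi8_eq_one_or_neg_one_of_odd (odd_mul_of_norm_inv h2a hn') with h1 | h1
  · left; rw [h1, Int.cast_one, one_mul]
  · right; rw [h1, Int.cast_neg, Int.cast_one, neg_one_mul]

/-- ★ **Triviality criterion**: if `n′A ≡ ±1 (mod 8)` (`χ₈(n′A) = 1`), the Artin symbol of `(β)` FIXES `y = e⁻¹ s(τ₀)`.
[cite: Cox2013, Thm. 15.17] [cite: Savitt2025, Thm. 1] -/
theorem artinSymbol_principal_apply_sqrtX_eq_self (h : cox2013_shimuraReciprocity_rayClassField)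
    (K : Type) [Field K] [NumberField K] (ι : K →+* ℂ)
    (hK : Literature.NumberTheory.EllipticCurves.IsImaginaryQuadratic K)
    (a b c : ℤ) (ha : 0 < a) (hD : b ^ 2 - 4 * a * c < 0) (hprim : Int.gcd (Int.gcd a b) c = 1) (h32 : (32 : ℤ) ∣ a)
    (θ : 𝓞 K) (hθ : ι (θ : K) = (a : ℂ) * ((heegnerTau (a, b, c) : ℍ) : ℂ))
    (hgen : ∀ z : 𝓞 K, ∃ A B : ℤ, (z : K) = A + B * (θ : K))
    (e : rayClassField K (Ideal.span {((32 : ℕ) : 𝓞 K)}) →+* ℂ)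
    (he : ∀ k : K, e (algebraMap K (rayClassField K (Ideal.span {((32 : ℕ) : 𝓞 K)})) k) = ι k)
    (β : 𝓞 K) (hβ : (β : K) ≠ 0)
    (hβm : toPrincipalIdeal (𝓞 K) K (Units.mk0 (β : K) hβ) ∈ idealsPrimeTo (Ideal.span {((32 : ℕ) : 𝓞 K)}))
    (A B : ℤ) (hAB : (β : K) = A + B * (θ : K))
    (n' : ℤ) (hn' : ((n' * (A ^ 2 - b * A * B + a * c * B ^ 2) : ℤ) : ZMod 32) = 1)
    (hχ : ZMod.χ₈ ((n' * A : ℤ) : ZMod 8) = 1)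
    (y : rayClassField K (Ideal.span {((32 : ℕ) : 𝓞 K)})) (hy : e y = etaQuotient 32 rS (heegnerTau (a, b, c))) :
    artinHom (galFrob K (rayClassField K (Ideal.span {((32 : ℕ) : 𝓞 K)})))
        (toPrincipalIdeal (𝓞 K) K (Units.mk0 (β : K) hβ)) y = y := by
  rw [artinSymbol_principal_apply_sqrtX h K ι hK a b c ha hD hprim h32 θ hθ hgen e he β hβ hβm A B hAB n' hn' y hy, hχ,
    Int.cast_one, one_mul]

/-- `χ₈(m) = 1` for `m ≡ 1 (mod 8)` and for `m ≡ 7 (mod 8)` — the residues of `±(odd square)·l^ε` with `l ≡ 1 (mod 8)`. [folklore] -/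
theorem chi8_eq_one_of_mod_eight {m : ℤ} (hm : m % 8 = 1 ∨ m % 8 = 7) : ZMod.χ₈ ((m : ℤ) : ZMod 8) = 1 := by
  rw [ZMod.χ₈_int_eq_if_mod_eight]
  have h2 : m % 2 = 1 := by omega
  rcases hm with h | h <;> simp [h, h2]

end Summit.BirchSwinnertonDyer.PrintCf2.TheoremAReciprocity

end
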